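import Literature.AlgebraicGeometry.AbelianVarieties.PoincareSheafSlices
import Literature.AlgebraicGeometry.Motives.AbelianVarietyPicZeroOfAmple
import Literature.AlgebraicGeometry.Motives.AbelianVarietyPhiThetaFibres
import HarnessLib

/-!
# Slices of the Poincaré sheaf on complex points: `Pic⁰(A) = {[𝒫|_{A × {b}}]}` and `b ↦ [𝒫|_{A × {b}}]` is injective

Layer `Literature/AlgebraicGeometry/AbelianVarieties`, namespace `Literature.AlgebraicGeometry.AbelianVarieties`. THEOREMS
ONLY; no named fact, no instance, no notation. Cell `hodgecm-mathlib` (D-0151), M1PRIME-DAG rung 0, J0b road (i) input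
(P-b) for the (R3a) assembly «`universal` on normal `T`» (B-p02 lineage), written in the B-p07 (J0a) currency. For a complex
abelian variety `A`, an ample `Θ`, `Â = A/K(Θ)` and ANY line bundle `𝒫` on `A × Â` with `(1 × φ_Θ)^*𝒫 ≅ Λ(𝒪(Θ))`:

* **`exists_detClass_eq_detClass_pullback_sliceAt`** — every HOMOGENEOUS line bundle `M` on `A` (`M ∈ Pic⁰(A)`) has the class
  of a slice: `[M] = [𝒫|_{A × {φ_Θ a}}]` for some `a ∈ A(ℂ)` — Mumford §8 Thm. 1 «`Pic⁰ = φ_L(X)`» (★ (R1a)_ℂ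
  `exists_linEquiv_weilDiv_of_forall_translate_linEquiv`) + the slice formula ★ `detClass_pullback_sliceAt_map_phiTheta`;
* **`map_phiTheta_eq_of_detClass_pullback_sliceAt_eq`**, **`eq_of_detClass_pullback_sliceAt_eq`** — the point of `Â` is
  determined by the class of the slice: `[𝒫|_{A×{b}}] = [𝒫|_{A×{b'}}] ⟹ b = b'` (★ (R1b)_ℂ
  `phiPic_cechClass_eq_iff_inv_mul_mem_KTheta`, ★ `surjective_map_phiTheta`).

These are the two point-set inputs («`Γ(ℂ)` is the graph of a function `T(ℂ) → Â(ℂ)`») of the seesaw/graph proof that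
`(Â, 𝒫)` satisfies the universal property over normal bases ([MilneAV2008] I §8; [MumfordAV1970] §8, §13). Banked capital;
HC_CM is proved only modulo the 7 printed citations until rung 0 closes.

## References

* [MumfordAV1970] D. Mumford, *Abelian Varieties* (1970), §8 Thm. 1 (p. 77) and pp. 78–80.
* [MilneAV2008] J. S. Milne, *Abelian Varieties* (2008), I §8 (pp. 36–40).
-/

noncomputable section

open CategoryTheory AlgebraicGeometry MonoidalCategory CartesianMonoidalCategory Opposite
open Literature.AlgebraicGeometry.Motives Literature.AlgebraicGeometry.Modules
open scoped MonObj

universe u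

namespace Literature.AlgebraicGeometry.AbelianVarieties

variable (A : AbelianVariety ℂ) {Θ : CartierDivisor A.X.left} (hΘ : Θ.IsAmple)
  {P : (A.prod (A.dualOf Θ hΘ)).X.left.Modules} (hP1 : HasRank P 1)
  (eP : Nonempty ((Scheme.Modules.pullback (AbelianVariety.Hom.toSchemeHom (A.oneProdPhiTheta hΘ))).obj P ≅
    mumfordSheaf A Θ))

include eP in
/-- The slice class in `φ`-form: `[𝒫|_{A × {φ_Θ a}}] = φ_{[Θ]}(a) = [D_a^Θ]`. [cite: MumfordAV1970, §8 (pp. 78–80)] -/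
theorem detClass_pullback_sliceAt_map_phiTheta_eq_cechClass_weilDiv (a : A.Points ℂ) :
    detClass ((HasRank.isFiniteLocallyFree' hP1).pullback
        (lift (𝟙 A.X) (toSpecOver A.X ≫ AlgPoints.map (A.phiTheta Θ hΘ).hom.hom.hom a)).left) =
      (A.weilDiv Θ a).cechClass := by
  rw [detClass_pullback_sliceAt_map_phiTheta A hΘ hP1 eP a, A.cechClass_weilDiv_eq_phiPic Θ a,
    phiPic, CartierDivisor.cechClass_pullback, div_eq_mul_inv]

include eP in
/-- **Every homogeneous line bundle on `A` is (up to isomorphism) a slice `𝒫|_{A × {φ_Θ(a)}}`** — `Pic⁰(A) = φ_Θ(A(ℂ))`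
(Mumford §8 Thm. 1 over `ℂ`, ★ `exists_linEquiv_weilDiv_of_forall_translate_linEquiv`), in class form.
[cite: MumfordAV1970, §8 Thm. 1 (p. 77)] -/
theorem exists_detClass_eq_detClass_pullback_sliceAt {M : A.X.left.Modules} (hM1 : HasRank M 1)
    (hM : IsHomogeneous A M) :
    ∃ a : A.Points ℂ, detClass (HasRank.isFiniteLocallyFree' hM1) =
      detClass ((HasRank.isFiniteLocallyFree' hP1).pullback
        (lift (𝟙 A.X) (toSpecOver A.X ≫ AlgPoints.map (A.phiTheta Θ hΘ).hom.hom.hom a)).left) := by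
  -- `M ≅ 𝒪(D)` with `D` translation invariant
  obtain ⟨D, -, ⟨φ⟩⟩ := (isHomogeneous_iff_exists_iso_lineBundle A hM1).1 hM
  have hD : ∀ x : A.Points ℂ, (D.pullback (A.translation x).left).LinEquiv D :=
    (isHomogeneous_lineBundle_iff_forall_linEquiv A D).1 ((isHomogeneous_iff_of_iso A φ).1 hM)
  -- Mumford §8 Thm. 1: `D ∼ t_a^*Θ − Θ`
  obtain ⟨a, ha⟩ := AbelianVariety.exists_linEquiv_weilDiv_of_forall_translate_linEquiv A hΘ D hD
  refine ⟨a, ?_⟩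
  rw [detClass_pullback_sliceAt_map_phiTheta_eq_cechClass_weilDiv A hΘ hP1 eP a,
    detClass_eq_of_iso φ (HasRank.isFiniteLocallyFree' hM1) D.toUnitCocycle.isFiniteLocallyFree_lineBundle,
    D.toUnitCocycle.detClass_lineBundle, ← (CartierDivisor.cechClass_eq_iff_linEquiv _ _).2 ha]
  rfl

include eP in
/-- **The slice class determines the point**, `a`-form: `[𝒫|_{A×{φ_Θ a}}] = [𝒫|_{A×{φ_Θ a'}}] ⟹ φ_Θ a = φ_Θ a'`
(★ (R1b)_ℂ: `D_a ∼ D_{a'} ⟺ a⁻¹a' ∈ K(Θ) ⟺ φ_Θ a = φ_Θ a'`). [cite: MumfordAV1970, §8 (pp. 78–80)] -/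
theorem map_phiTheta_eq_of_detClass_pullback_sliceAt_eq (a a' : A.Points ℂ)
    (h : detClass ((HasRank.isFiniteLocallyFree' hP1).pullback
        (lift (𝟙 A.X) (toSpecOver A.X ≫ AlgPoints.map (A.phiTheta Θ hΘ).hom.hom.hom a)).left) =
      detClass ((HasRank.isFiniteLocallyFree' hP1).pullback
        (lift (𝟙 A.X) (toSpecOver A.X ≫ AlgPoints.map (A.phiTheta Θ hΘ).hom.hom.hom a')).left)) :
    AlgPoints.map (A.phiTheta Θ hΘ).hom.hom.hom a = AlgPoints.map (A.phiTheta Θ hΘ).hom.hom.hom a' := by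
  rw [detClass_pullback_sliceAt_map_phiTheta_eq_cechClass_weilDiv A hΘ hP1 eP,
    detClass_pullback_sliceAt_map_phiTheta_eq_cechClass_weilDiv A hΘ hP1 eP, CartierDivisor.cechClass_eq_iff_linEquiv] at h
  exact (A.map_phiTheta_eq_iff_weilDiv_linEquiv hΘ a a').2 h

include hP1 eP in
/-- **The slice class determines the point: `[𝒫|_{A × {b}}] = [𝒫|_{A × {b'}}] ⟹ b = b'`** for complex points `b, b'`
of `Â` (every `b` is `φ_Θ a`, ★ `surjective_map_phiTheta`). This is the injectivity of `b ↦ [𝒫_b]`, Milne's uniqueness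
half of the universal property at `T = Spec ℂ`. [cite: MilneAV2008, I §8 (pp. 36–37)] [cite: MumfordAV1970, §8 (pp. 78–80)] -/
theorem eq_of_detClass_pullback_sliceAt_eq (b b' : (A.dualOf Θ hΘ).Points ℂ)
    (h : detClass ((HasRank.isFiniteLocallyFree' hP1).pullback (lift (𝟙 A.X) (toSpecOver A.X ≫ b)).left) =
      detClass ((HasRank.isFiniteLocallyFree' hP1).pullback (lift (𝟙 A.X) (toSpecOver A.X ≫ b')).left)) :
    b = b' := by
  obtain ⟨a, rfl⟩ := A.surjective_map_phiTheta hΘ b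
  obtain ⟨a', rfl⟩ := A.surjective_map_phiTheta hΘ b'
  exact map_phiTheta_eq_of_detClass_pullback_sliceAt_eq A hΘ hP1 eP a a' h

end Literature.AlgebraicGeometry.AbelianVarieties

end
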